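import Summits.MatrixMultiplication.OmegaCensus.SmallFormats.BoxCertificateParity
import HarnessLib

/-!
# ω-census family (a): `BoxCert` certificates with parity leaves AND single-variable pattern leaves

Cell `pub-omega` (unit `pub-omega-tensor-g11`), topic `Summits/MatrixMultiplication/OmegaCensus` (sub-folder `SmallFormats`).
Framing (verbatim): lottery ticket; floor = certified bounds/negative ranges. HONEST FRAMING: generic bookkeeping, no matrix
multiplication content. `CertQ` extends `CertP` (`BoxCertificateParity`: multiplier leaves, infeasible-row leaves, rectangle-parity
leaves, branches) by the leaf kind `pat i`: it closes a box that FIXES the `i`-th listed variable of a `PatternData` table to a value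
whose parity differs from the prescribed bit. Soundness (`CertQ.sum_lt_of_check`) is relative to the two side hypotheses
`ParityData.OK x` (rectangle sums even) and `PatternData.OK x` (each listed variable has the listed parity). PURPOSE (successor
blueprint `pub-omega-tensor-g11/METHOD-PARITY-g11.md` §3): in the kernel replay of `M₅(4) ≤ 111` the parity lemma
(`MatMul22nRankGF5XCapParity`) gives `μ(w,x) ≡ s + α_x + β_w (mod 2)`; after the case split on the pattern `(α, β)` every rank-one
variable has a KNOWN parity, which is exactly a `PatternData.OK` hypothesis, and wrong-parity sub-boxes cost one `pat` line each.
-/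

namespace Summit.MatrixMultiplication.OmegaCensus.SmallFormats.BoxCert

open Finset

/-- Pattern side information: `n` variables `var i` with prescribed parities `bit i ∈ {0,1}`. -/
structure PatternData where
  /-- number of listed variables -/
  n : ℕ
  /-- the `i`-th listed variable -/
  var : ℕ → ℕ
  /-- its prescribed parity -/
  bit : ℕ → ℕ

/-- `x` has the prescribed parity on every listed variable. -/
def PatternData.OK (Q : PatternData) (x : ℕ → ℕ) : Prop := ∀ i < Q.n, x (Q.var i) % 2 = Q.bit i

/-- Branch-and-bound certificates with rectangle-parity leaves and pattern leaves. -/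
inductive CertQ where
  /-- pruned by multipliers `y` (numerators over the common denominator `D`) -/
  | leaf (y : ℕ → ℕ) : CertQ
  /-- pruned because row `r` is violated by every point of the box -/
  | infeasible (r : ℕ) : CertQ
  /-- pruned because quadruple `i` of the parity table is fixed by the box to values with odd sum -/
  | parity (i : ℕ) : CertQ
  /-- pruned because listed variable `i` of the pattern table is fixed by the box to a value of the wrong parity -/
  | pat (i : ℕ) : CertQ
  /-- split on `x j ≥ v + 1` (first child) versus `x j ≤ v` (second child) -/
  | branch (j v : ℕ) (up down : CertQ) : CertQ

variable (S : System) (P : ParityData) (Q : PatternData)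

/-- The pattern-leaf test: listed variable `i` exists, is fixed by the box, and the fixed value has the wrong parity. -/
def PatternData.leafOK (s i : ℕ) (path : List (ℕ × ℕ × ℕ)) : Bool :=
  decide (i < Q.n) && (decide (loOf path (Q.var i) = hiOf s path (Q.var i)) && decide (loOf path (Q.var i) % 2 ≠ Q.bit i))

/-- The certificate checker (pure `ℕ/ℤ` arithmetic, meant for `decide +kernel`). -/
def CertQ.check (D T s : ℕ) : CertQ → List (ℕ × ℕ × ℕ) → Bool
  | .leaf y, path => S.leafOK D T s y path
  | .infeasible r, path => decide (r < S.M) && S.rowInfeasible s r path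
  | .parity i, path => P.leafOK s i path
  | .pat i, path => Q.leafOK s i path
  | .branch j v up dn, path =>
      decide (loOf path j ≤ v) && decide (v < hiOf s path j) &&
        up.check D T s ((j, v + 1, hiOf s path j) :: path) && dn.check D T s ((j, loOf path j, v) :: path)

/-- **Pattern-leaf soundness**: no point of the box has the prescribed parity at the fixed wrong-parity variable. -/
theorem PatternData.false_of_leafOK {s i : ℕ} {path : List (ℕ × ℕ × ℕ)} (h : Q.leafOK s i path = true) {x : ℕ → ℕ}
    (hbox : InBox s path x) (hpat : Q.OK x) : False := by
  simp only [PatternData.leafOK, Bool.and_eq_true, decide_eq_true_eq] at h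
  obtain ⟨hi, hfix, hne⟩ := h
  have hv := hpat i hi
  rw [eq_loOf_of_inBox hbox hfix] at hv
  exact hne hv

/-- **Soundness of the checker** (relative to the side hypotheses `P.OK x` and `Q.OK x`). -/
theorem CertQ.sum_lt_of_check (hwf : S.ColWF) {D T s : ℕ} :
    ∀ (c : CertQ) (path : List (ℕ × ℕ × ℕ)), c.check S P Q D T s path = true →
      ∀ x : ℕ → ℕ, InBox s path x → S.Feasible x → P.OK x → Q.OK x → ∑ j ∈ range S.N, x j < T
  | .leaf y, path, h, x, hbox, hfeas, _, _ => S.sum_lt_of_leafOK hwf (by simpa [CertQ.check] using h) hbox hfeas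
  | .infeasible r, path, h, x, hbox, hfeas, _, _ => by
      simp only [CertQ.check, Bool.and_eq_true, decide_eq_true_eq] at h
      exact (S.false_of_rowInfeasible h.1 h.2 hbox hfeas).elim
  | .parity i, path, h, x, hbox, _, hpar, _ => by
      simp only [CertQ.check] at h
      exact (P.false_of_leafOK h hbox hpar).elim
  | .pat i, path, h, x, hbox, _, _, hpat => by
      simp only [CertQ.check] at h
      exact (Q.false_of_leafOK h hbox hpat).elim
  | .branch j v up dn, path, h, x, hbox, hfeas, hpar, hpat => by
      simp only [CertQ.check, Bool.and_eq_true, decide_eq_true_eq] at h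
      obtain ⟨⟨⟨_, _⟩, hup⟩, hdn⟩ := h
      rcases Nat.lt_or_ge v (x j) with hv | hv
      · exact CertQ.sum_lt_of_check hwf up _ hup x (inBox_up hbox hv) hfeas hpar hpat
      · exact CertQ.sum_lt_of_check hwf dn _ hdn x (inBox_down hbox hv) hfeas hpar hpat

/-- **Root form**: a passing certificate at the root box bounds every feasible `x ≤ s` satisfying both side hypotheses by `∑_{j<N} x j < T`. -/
theorem CertQ.sum_lt_of_check_root (hwf : S.ColWF) {D T s : ℕ} (c : CertQ) (h : c.check S P Q D T s [] = true)
    (x : ℕ → ℕ) (hx : ∀ j, x j ≤ s) (hfeas : S.Feasible x) (hpar : P.OK x) (hpat : Q.OK x) : ∑ j ∈ range S.N, x j < T :=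
  CertQ.sum_lt_of_check S P Q hwf c [] h x (inBox_nil hx) hfeas hpar hpat

/-- Assembly step for certificate skeletons: a branch node passes if its side conditions hold and both children pass. -/
theorem CertQ.check_branch {D T s j v : ℕ} {up dn : CertQ} {path : List (ℕ × ℕ × ℕ)}
    (h1 : loOf path j ≤ v) (h2 : v < hiOf s path j)
    (hu : up.check S P Q D T s ((j, v + 1, hiOf s path j) :: path) = true)
    (hd : dn.check S P Q D T s ((j, loOf path j, v) :: path) = true) :
    (CertQ.branch j v up dn).check S P Q D T s path = true := by
  simp [CertQ.check, h1, h2, hu, hd]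

/-! ## A toy instance: `x₀ + x₁ ≤ 1` on `[0,1]²`, pattern "`x₀` odd, `x₁` odd" (so no feasible point with the pattern); the certificate
branches on `x₀`: the box `x₀ = 1` then branches on `x₁` (`x₁ = 1` violates the row, `x₁ = 0` is a `pat` leaf), and `x₀ = 0` is a
`pat` leaf. Claim `∑ < 1`. -/

/-- Toy pattern table: variables `0, 1` both odd. -/
def toyQ : PatternData := ⟨2, fun i => i, fun _ => 1⟩

/-- The toy certificate passes. -/
example : (CertQ.branch 0 0 (CertQ.branch 1 0 (CertQ.infeasible 0) (CertQ.pat 1)) (CertQ.pat 0)).check toy toyP toyQ 1 1 1 [] = true := by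
  decide +kernel

end Summit.MatrixMultiplication.OmegaCensus.SmallFormats.BoxCert
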